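import Mathlib
import HarnessLib
import HarnessLib.Audit
import Summits.Ventures.CertifiedManyBodySolver.HubbardAlg.MbsolverRungLeaves
import Summits.Ventures.CertifiedManyBodySolver.Rows.DopedTLCorr
import Summits.Ventures.CertifiedManyBodySolver.Rows.DopedTLBondSingletCellsTpm1o4
import Summits.Ventures.CertifiedManyBodySolver.Observables.RungLeaves
import Summits.Ventures.CertifiedManyBodySolver.Certificates.HubbardSquare_n7o8_obs0b_EXT5Lp_tp0_pd21up_j244844

/-!
Route: M3ObsPd21UnitWindowViaRows

DORMANT since 2026-09-02T04:37:41Z (reconciler: no traction for 5 d (last activity statement-checked at 2026-08-28T03:48:43Z); parked, not closed — `ledger route dormant route-Ventures-M3ObsPd21UnitWindowViaRows --off` to reactivate) — unstaffed, not closed; items shared with open routes are served there. `ledger route dormant <id> --off` reactivates.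

# Route M3ObsPd21UnitWindowViaRows — M3′-obs at-range pair window P̄_d(2,1) of width ≤ 1 at (8, 7/8,
0) as the declared split [−1/2, 1/2] — two certified orbit rows at the cap of record and the cap
leaf decide the rung leaf

It suffices to show X = Pd21LowerRowCapRS_ge_mHalf ∧ Pd21NegRowCapRS_ge_mHalf ∧ CapRS: over the
torus-limit ground-state class at (U, n, t′) = (8, 7/8, 0),
certified D₄-orbit LOWER rows q ≤ ⟨W⟩ and q′ ≤ ⟨−W⟩ with q, q′ ≥ −1/2 on the two-point d-wave pair
word W = Φ_0† Φ_(2,1) (the two Φ's share no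
site: the correlator AT RANGE), both at the energy cap of record u_RS = −12525490015723/2⁴⁴,
together with the cap leaf
`MbsolverRungLeaves.M3Upper_tp0_le_RS`, give by
`Observables.M3ObsPairWindowAtRangeR21At_tp0_of_orbitRows` (dictionary
`m3CorrOrbitLowerRow_dWavePair_iff`, p402323) and row monotonicity the certified two-sided window
[−1/2, 1/2] on the D₄-class mean P̄_d(2,1)(ω) for every ω
of the class, i.e. the rung leaf `M3ObsPairWindowAtRange_r21_tp0` (width ≤ 1 = the obs cell's
pre-registered KILL threshold K5). D-0145 LINES
registration, R-OBS; producers = hubbard-obs EXT5-L⁺ / T2 lanes (pd21lo / pd21up edges) and this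
cell's cap lane. HONEST FRAMING: first certified bounds;
a window at range says nothing about long-range order; today's certified window has width 1.3788
(pd21lo −0.5610, pd21up +0.8178 at K = 40, cap #354,
floor #473; `Certificates.obs0b_pd21_EXT5Lp_tp0_width`), so BOTH rows are short ([−0.561, 0.818] ⊄
[−0.5, 0.5]); the physical value is
|P̄_d(2,1)| ≲ 10⁻² (Scalapino1995; QinEtAl2020), deep inside. Not a superconductivity verdict.
Lean: `(∃ q : ℚ, (-1/2 : ℚ) ≤ q ∧ Summit.Ventures.CertifiedManyBodySolver.M3CorrOrbitLowerRow 0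
(-12525490015723/17592186044416) q Finset.univ
(Literature.MathematicalPhysics.QuantumLattice.pairRegion (insert (0 :
Literature.Probability.LatticeModels.Site 2)
Literature.MathematicalPhysics.QuantumLattice.unitSteps) 0 ∪
Literature.MathematicalPhysics.QuantumLattice.pairRegion (insert (0 :
Literature.Probability.LatticeModels.Site 2)
Literature.MathematicalPhysics.QuantumLattice.unitSteps) ![2, 1])
(Literature.MathematicalPhysics.QuantumLattice.fermionEmbed
(Literature.MathematicalPhysics.QuantumLattice.PolySite.incl Finset.subset_union_left)
(Literature.MathematicalPhysics.QuantumLattice.localPairAt (insert (0 :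
Literature.Probability.LatticeModels.Site 2)
Literature.MathematicalPhysics.QuantumLattice.unitSteps)
Literature.MathematicalPhysics.QuantumLattice.dWaveFormFactor 0)ᴴ *
Literature.MathematicalPhysics.QuantumLattice.fermionEmbed
(Literature.MathematicalPhysics.QuantumLattice.PolySite.incl Finset.subset_union_right)
(Literature.MathematicalPhysics.QuantumLattice.localPairAt (insert (0 :
Literature.Probability.LatticeModels.Site 2)
Literature.MathematicalPhysics.QuantumLattice.unitSteps)
Literature.MathematicalPhysics.QuantumLattice.dWaveFormFactor ![2, 1]))) ∧ (∃ q : ℚ, (-1/2 : ℚ) ≤ q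
∧ Summit.Ventures.CertifiedManyBodySolver.M3CorrOrbitLowerRow 0 (-12525490015723/17592186044416) q
Finset.univ (Literature.MathematicalPhysics.QuantumLattice.pairRegion (insert (0 :
Literature.Probability.LatticeModels.Site 2)
Literature.MathematicalPhysics.QuantumLattice.unitSteps) 0 ∪
Literature.MathematicalPhysics.QuantumLattice.pairRegion (insert (0 :
Literature.Probability.LatticeModels.Site 2)
Literature.MathematicalPhysics.QuantumLattice.unitSteps) ![2, 1])
(-(Literature.MathematicalPhysics.QuantumLattice.fermionEmbed
(Literature.MathematicalPhysics.QuantumLattice.PolySite.incl Finset.subset_union_left)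
(Literature.MathematicalPhysics.QuantumLattice.localPairAt (insert (0 :
Literature.Probability.LatticeModels.Site 2)
Literature.MathematicalPhysics.QuantumLattice.unitSteps)
Literature.MathematicalPhysics.QuantumLattice.dWaveFormFactor 0)ᴴ *
Literature.MathematicalPhysics.QuantumLattice.fermionEmbed
(Literature.MathematicalPhysics.QuantumLattice.PolySite.incl Finset.subset_union_right)
(Literature.MathematicalPhysics.QuantumLattice.localPairAt (insert (0 :
Literature.Probability.LatticeModels.Site 2)
Literature.MathematicalPhysics.QuantumLattice.unitSteps)
Literature.MathematicalPhysics.QuantumLattice.dWaveFormFactor ![2, 1])))) ∧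
Summit.Ventures.CertifiedManyBodySolver.MbsolverRungLeaves.M3Upper_tp0_le_RS`

## Assembly
Pure logic: row monotonicity moves both certified q's to exactly −1/2, then
`M3ObsPairWindowAtRangeR21At_tp0_of_orbitRows` with lo = −1/2, hi = 1/2
(`qlo ≤ −qup` and `−qup − qlo ≤ 1` by `norm_num`) and the cap witness `hi ≤ u_RS`.

CLOSES_TARGET: closes rung M3obsRange of Ventures/CertifiedManyBodySolver: Summit.Ventures.CertifiedManyBodySolver.Observables.M3ObsPairWindowAtRange_r21_tp0 (D-0061; not the summit Statement) — the deciding theorem of this route concludes that registered leaf (Ventures/CertifiedManyBodySolver: no summit Statement) (class rung: servable and labelled, never counted as concluding the summit Statement).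

Rationale: WHY THIS LINE. The at-range leaf is the obs cell's first anchor-level window; as typed it is an
∃-window sentence but NOT vacuous (the inner ∀ over the class binds
both ends to the same lo, hi; BC7 probe CLEAN), and its reduction theorem takes exactly three
certified inputs — a lower orbit row on W, a lower
orbit row on −W (both at an energy cap u) and the cap row. The route DECLARES the symmetric split
[−1/2, 1/2] around the physical value ≈ 0 and the
cap of record u_RS, so each producer gets one item: pd21lo must gain +0.061 (−0.561 → −0.5), pd21up
must gain −0.318 (0.818 → 0.5), the cap lane
kernel-replays #524; certificates computed at any looser cap transport by `M3CorrOrbitLowerRow.mono`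
(WangEtAl2024 §III) and better q by the same
lemma. The upper side is the hard one (×1.6): the normalisation of the negated two-point word leaves
no floor (unlike F₂), so the slack is pure
relaxation strength at footprint (≤3,5) (Hastings2022; Han2020Bootstrap) — a T2-class word set or a
tighter cap is the lever. No superconductivity
prediction is made by this line.

RANKED CRUXES. #2 Pd21NegRowCapRS_ge_mHalf (crux) — a certified D₄-orbit lower row q′ ≤
⟨−Φ_0†Φ_(2,1)⟩ with q′ ≥ −1/2 (i.e. P̄_d(2,1) ≤ 1/2) over the class at cap u_RS (producers:
hubbard-obs pd21up edge; today −q′ = 0.8178 at K = 40: needs −0.318). [difficulty: L] (why it might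
fail: the converged optimum of the footprint-(≤3,5) EXT5-L⁺ relaxation for the UPPER side may stay
above 1/2 (no normalisation floor helps here; degree-4 words under-constrain range-√5 pair products,
Hastings2022); needs T2-class words or a tighter cap.) [Scalapino1995, Hastings2022,
Han2020Bootstrap, WangEtAl2024]
#3 Pd21LowerRowCapRS_ge_mHalf (crux) — a certified D₄-orbit lower row q ≤ ⟨Φ_0†Φ_(2,1)⟩ with q ≥
−1/2 over the class at cap u_RS (producers: hubbard-obs pd21lo edge; today q = −0.5610 at K = 40,
cap #354, floor #473: needs +0.061). [difficulty: M] (why it might fail: only +0.061 is needed but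
the K = 40 dual may already be near the relaxation optimum on this side; if the converged primal
sits below −1/2 at cap u_RS the split must move (new route), not the certificate.) [Scalapino1995,
Han2020Bootstrap, WangEtAl2024, QinEtAl2020]
#4 CapRS (crux) — the cap leaf of record BY NAME, `MbsolverRungLeaves.M3Upper_tp0_le_RS` (∃ hi ≤
−12525490015723/2⁴⁴, e ≤ hi): kernel replay of the all-k plaquette-RS dressed-box-tiling certificate
#524 (`rungLeaf_M3Upper_tp0_le_RS_of_r524`), shared with route M3ObsPairLroHalfViaF2. [difficulty:
M] (why it might fail: the all-k node is a FORMAT-dbt2 §3 identity over a bond-dimension-299 MPS on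
the 32 × 4 box; its exact-arithmetic kernel replay may exceed interval/size budgets — the bound is
variational, so the risk is replay, not truth.) [Ruelle1969, ZhengEtAl2017, QinEtAl2020]

TWO-LAYER PLAN. Foreseen (BC3 birth skeletons, nothing filed now): each row crux ⇐ its DIRECT
two-row node at the obs cell's cap/floor of record
(`M3EnergyLowerRow 0 q₄₇₃ → orbit row at cap u₃₅₄` with the target q) → Floor473 replay → cap
transport u_RS ≤ u₃₅₄ (`M3CorrOrbitLowerRow.mono`);
CapRS ⇐ `cert_dbt299plaqRS_allk` replay → `rungLeaf_M3Upper_tp0_le_RS_of_r524`. Rungs (plan-only):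
today's nodes `cert_obs0b_pd21_EXT5Lp_M3U8tp0_c354f473_lo`
(−0.5610) / the pd21up node (0.8178), and `cert_dbt299plaqRS_k64`.

KILL CRITERIA. A certified row placing P̄_d(2,1) outside [−1/2, 1/2] for some state of the class
with e ≤ u_RS refutes the corresponding crux (physically absurd:
|P_d(2,1)| ≲ 10⁻²); a certified lower energy row above u_RS refutes CapRS. A converged EXT5-L⁺/T2
primal optimum outside [−1/2, 1/2] on either side
at cap u_RS kills this relaxation class for that crux (pivot = tighter cap / larger word set /
shifted split = a new route).

NOT DECOMPOSED YET. Which word set closes the upper side's 0.318; whether an asymmetric split (e.g.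
[−0.45, 0.55]) should replace the symmetric one once the converged
primal values are known (a restate in tenure); the generic-displacement leaf `M3ObsPairWindowAt_tp0
r W` for other r (no registered closer).

CHEAPEST FALSIFIER. Lookups run by this seat: today's certified width 1.3788 > 1 and pd21lo −0.5610
< −1/2 (SketchE `todays_pd21_width_gt_one`, `todays_pd21lo_short`,
norm_num; tree `Certificates.obs0b_pd21_EXT5Lp_tp0_width`), so no dated object closes either row;
cap order u_RS ≤ u₃₅₄ (SketchD `capRS_le_cap354`).
The cheapest real kill is one converged FO run of the obs lane reporting the primal P̄_d(2,1) range
at cap u_RS outside [−1/2, 1/2] (0 kit from this seat).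

NUMBERS. Split [−1/2, 1/2], width 1 (= K5). Today (K = 40, cap u₃₅₄ = −0.70594, floor #473 =
−0.83723): pd21lo q = −745639418572725264404018550725883981/2¹²⁰ =
−0.5609567515; width 1832696077484509206507186332845844711/2¹²⁰ = 1.3787672869 ⇒ upper end
+0.8178105354; distances: lower +0.0610, upper −0.3178.
Kinematic box [−4, 4]; physical |P̄_d(2,1)| ≲ 10⁻² (DMRG/AFQMC floats, t′ = 0). Declared cap u_RS =
−12525490015723/2⁴⁴ = −0.7119916754.

DEFINITION REQUESTS. None.

Novelty: Searches (2026-08-27, shared with route M3ObsPairLroHalfViaF2): corpus hybrid "rigorous upper bound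
d-wave pairing correlation Hubbard model
semidefinite relaxation certified" (books only, no certified correlator windows); galaxy pdf
"pairing correlations|off-diagonal long-range
order|Hubbard bootstrap" (noise); venture tree: the only certified P_d(2,1) windows at (8, 7/8, 0)
are the programme's pd21 edges (j242464/j244844,
T2direct j242269).
Nearest prior art found: Scalapino1995 §2 (observable), Han2020Bootstrap, arXiv:2507.02386
(bootstrap correlator bounds, floats), hubbard-obs
p402323 (dictionary) / p405324 (leaf + reduction theorem).
Delta: the first typed decision of the at-range window leaf as a declared three-item split (two
orbit rows at the cap of record ∧ cap leaf); a
registration (crew rung route), not a mechanism.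
Claimed grade: known  [refs: 2507.02386, Scalapino1995]

Barriers (technique_class: sdp-correlator-ceiling, certified-upper-bound, energy-window): - technique_class: sdp-correlator-ceiling, certified-upper-bound, energy-window
- Literature.Barriers.HubbardSuperconductivity.EnergyWindowCeilingResolution: inside its class —
both rows are read through the energy window (cap u_RS vs floor); the bet is that width 1 around a
value ≈ 0 is coarse enough at window 0.1176, and CapRS is the lever that narrows it.
- Literature.Barriers.HubbardSuperconductivity.OrderParameterInvisibleToGroundStateConstraints: not
applicable — a two-sided window on a finite-range correlator, not a statement of order.
- Literature.Barriers.HubbardSuperconductivity.DegreeFourSosMissesSecondOrderPerturbation: inside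
its class for both row cruxes (degree-4 words under-constrain range-√5 pair products); the bet is
T2-class words / tighter cap, not exactness.
- Literature.Barriers.HubbardSuperconductivity.SignProblemNPHard: outside its class — nothing is
sampled.
- Negatives index: `ledger negatives --problem Ventures` — no refuted statement concerns a pd21
orbit row or the RS cap.

History (route lifecycle, newest last):
- 2026-09-02T04:37:41Z · DORMANT — reconciler: no traction for 5 d (last activity statement-checked at 2026-08-28T03:48:43Z); parked, not closed — `ledger route dormant route-Ventures-M3ObsPd21Un (operator:999:1456411)

sub-problem: CertifiedManyBodySolver · status: dormant · opened planner-hubbard-m3-lines-1-g0-0 2026-08-27T21:19:47Z · rev 2 · ledger route-Ventures-M3ObsPd21UnitWindowViaRows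
GENERATED by the gate from the ledger (D-0016/17). Provers cite these decls: `theorem foo : Summit.Ventures.CertifiedManyBodySolver.Theses.M3ObsPd21UnitWindowViaRows.<Decl> := …` in Summits/Ventures/CertifiedManyBodySolver/Theorems/<Name>.lean.
-/

namespace Summit.Ventures.CertifiedManyBodySolver.Theses.M3ObsPd21UnitWindowViaRows

open scoped BigOperators Topology Manifold Classical MeasureTheory ProbabilityTheory Matrix InnerProductSpace ComplexConjugate ContinuousMap
open Filter Set Function TopologicalSpace MeasureTheory

-- H21.Audit: Ventures rung route — no summit Statement decl; the expected conclusion is the closer leaf tagged below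
attribute [summit_statement] _root_.Summit.Ventures.CertifiedManyBodySolver.Observables.M3ObsPairWindowAtRange_r21_tp0

/-- item stmt-Ventures-22824 · crux · rank 2 · open · by planner
why it might fail: the converged optimum of the footprint-(≤3,5) EXT5-L⁺ relaxation for the UPPER side may stay above 1/2 (no normalisation floor helps here; degree-4 words under-constrain range-√5 pair products, Hastings2022); needs T2-class words or a tighter cap.
sources: Scalapino1995, Hastings2022, Han2020Bootstrap, WangEtAl2024
[crux] a certified D₄-orbit lower row q′ ≤ ⟨−Φ_0†Φ_(2,1)⟩ with q′ ≥ −1/2 (i.e. P̄_d(2,1) ≤ 1/2) over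
the class at cap u_RS (producers: hubbard-obs pd21up edge; today −q′ = 0.8178 at K = 40: needs
−0.318). [difficulty: L] -/
@[route_item "route-Ventures-M3ObsPd21UnitWindowViaRows"]
def Pd21NegRowCapRS_ge_mHalf : Prop :=
  ∃ q : ℚ, (-1/2 : ℚ) ≤ q ∧ Summit.Ventures.CertifiedManyBodySolver.M3CorrOrbitLowerRow 0 (-12525490015723/17592186044416) q Finset.univ (Literature.MathematicalPhysics.QuantumLattice.pairRegion (insert (0 : Literature.Probability.LatticeModels.Site 2) Literature.MathematicalPhysics.QuantumLattice.unitSteps) 0 ∪ Literature.MathematicalPhysics.QuantumLattice.pairRegion (insert (0 : Literature.Probability.LatticeModels.Site 2) Literature.MathematicalPhysics.QuantumLattice.unitSteps) ![2, 1]) (-(Literature.MathematicalPhysics.QuantumLattice.fermionEmbed (Literature.MathematicalPhysics.QuantumLattice.PolySite.incl Finset.subset_union_left) (Literature.MathematicalPhysics.QuantumLattice.localPairAt (insert (0 : Literature.Probability.LatticeModels.Site 2) Literature.MathematicalPhysics.QuantumLattice.unitSteps) Literature.MathematicalPhysics.QuantumLattice.dWaveFormFactor 0)ᴴ * Literature.MathematicalPhysics.QuantumLattice.fermionEmbed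 (Literature.MathematicalPhysics.QuantumLattice.PolySite.incl Finset.subset_union_right) (Literature.MathematicalPhysics.QuantumLattice.localPairAt (insert (0 : Literature.Probability.LatticeModels.Site 2) Literature.MathematicalPhysics.QuantumLattice.unitSteps) Literature.MathematicalPhysics.QuantumLattice.dWaveFormFactor ![2, 1])))

/-- item stmt-Ventures-22825 · crux · rank 3 · open · by planner
why it might fail: only +0.061 is needed but the K = 40 dual may already be near the relaxation optimum on this side; if the converged primal sits below −1/2 at cap u_RS the split must move (new route), not the certificate.
sources: Scalapino1995, Han2020Bootstrap, WangEtAl2024, QinEtAl2020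
[crux] a certified D₄-orbit lower row q ≤ ⟨Φ_0†Φ_(2,1)⟩ with q ≥ −1/2 over the class at cap u_RS
(producers: hubbard-obs pd21lo edge; today q = −0.5610 at K = 40, cap #354, floor #473: needs
+0.061). [difficulty: M] -/
@[route_item "route-Ventures-M3ObsPd21UnitWindowViaRows"]
def Pd21LowerRowCapRS_ge_mHalf : Prop :=
  ∃ q : ℚ, (-1/2 : ℚ) ≤ q ∧ Summit.Ventures.CertifiedManyBodySolver.M3CorrOrbitLowerRow 0 (-12525490015723/17592186044416) q Finset.univ (Literature.MathematicalPhysics.QuantumLattice.pairRegion (insert (0 : Literature.Probability.LatticeModels.Site 2) Literature.MathematicalPhysics.QuantumLattice.unitSteps) 0 ∪ Literature.MathematicalPhysics.QuantumLattice.pairRegion (insert (0 : Literature.Probability.LatticeModels.Site 2) Literature.MathematicalPhysics.QuantumLattice.unitSteps) ![2, 1]) (Literature.MathematicalPhysics.QuantumLattice.fermionEmbed (Literature.MathematicalPhysics.QuantumLattice.PolySite.incl Finset.subset_union_left) (Literature.MathematicalPhysics.QuantumLattice.localPairAt (insert (0 : Literature.Probability.LatticeModels.Site 2) Literature.MathematicalPhysics.QuantumLattice.unitSteps)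 Literature.MathematicalPhysics.QuantumLattice.dWaveFormFactor 0)ᴴ * Literature.MathematicalPhysics.QuantumLattice.fermionEmbed (Literature.MathematicalPhysics.QuantumLattice.PolySite.incl Finset.subset_union_right) (Literature.MathematicalPhysics.QuantumLattice.localPairAt (insert (0 : Literature.Probability.LatticeModels.Site 2) Literature.MathematicalPhysics.QuantumLattice.unitSteps) Literature.MathematicalPhysics.QuantumLattice.dWaveFormFactor ![2, 1]))

/-- item stmt-Ventures-22687 · crux · rank 4 · open · by planner
why it might fail: the all-k node is a FORMAT-dbt2 §3 identity over a bond-dimension-299 MPS on the 32 × 4 box; its exact-arithmetic kernel replay may exceed interval/size budgets — the bound is variational, so the risk is replay, not truth.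
sources: Ruelle1969, ZhengEtAl2017, QinEtAl2020
[crux] the cap leaf of record BY NAME, `MbsolverRungLeaves.M3Upper_tp0_le_RS`: ∃ hi ≤
−12525490015723/2⁴⁴ = −0.7119916754 with e(1,0,8,7/8) ≤ hi — the kernel replay of the all-k
plaquette-RS dressed-box-tiling certificate #524 (`Certificates.cert_dbt299plaqRS_allk` →
`rungLeaf_M3Upper_tp0_le_RS_of_r524`), or any tighter certified cap. [difficulty: M] -/
@[route_item "route-Ventures-M3ObsPd21UnitWindowViaRows"]
def CapRS : Prop :=
  Summit.Ventures.CertifiedManyBodySolver.MbsolverRungLeaves.M3Upper_tp0_le_RS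

/-- item stmt-Ventures-22826 · assembly · rank 1 · open · by planner
sources: Scalapino1995, WangEtAl2024
[assembly] Pd21LowerRowCapRS_ge_mHalf → Pd21NegRowCapRS_ge_mHalf → CapRS →
M3ObsPairWindowAtRange_r21_tp0. -/
@[route_item "route-Ventures-M3ObsPd21UnitWindowViaRows"]
def Assembly : Prop :=
  Pd21LowerRowCapRS_ge_mHalf → Pd21NegRowCapRS_ge_mHalf → CapRS → Summit.Ventures.CertifiedManyBodySolver.Observables.M3ObsPairWindowAtRange_r21_tp0

/-! D-0027 §2.1 — DECIDING THEOREM (planner-authored via `route open/edit --closes-file`; by planner-hubbard-m3-lines-1-g0-0 2026-08-27T21:19:47Z):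
its hypotheses are this route's items and its conclusion the registered leaf `Summit.Ventures.CertifiedManyBodySolver.Observables.M3ObsPairWindowAtRange_r21_tp0` (rung M3obsRange, D-0061) (glue_lint), and it elaborates with this file. -/

@[closes "route-Ventures-M3ObsPd21UnitWindowViaRows"] theorem closes (h₂ : Pd21LowerRowCapRS_ge_mHalf) (h₃ : Pd21NegRowCapRS_ge_mHalf) (h₄ : CapRS) :
    Summit.Ventures.CertifiedManyBodySolver.Observables.M3ObsPairWindowAtRange_r21_tp0 := by
  have hA : Assembly := by
    intro hL hU hC
    obtain ⟨qlo, hqlo, hlo⟩ := hL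
    obtain ⟨qup, hqup, hup⟩ := hU
    obtain ⟨hi, hhi, hE⟩ := hC
    show Summit.Ventures.CertifiedManyBodySolver.Observables.M3ObsPairWindowAtRangeR21At_tp0 1
    exact Summit.Ventures.CertifiedManyBodySolver.Observables.M3ObsPairWindowAtRangeR21At_tp0_of_orbitRows
      (qlo := -1/2) (qup := -1/2)
      (Summit.Ventures.CertifiedManyBodySolver.M3CorrOrbitLowerRow.mono hlo le_rfl hqlo)
      (Summit.Ventures.CertifiedManyBodySolver.M3CorrOrbitLowerRow.mono hup le_rfl hqup)
      hE hhi (by norm_num) (by norm_num)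
  exact hA h₂ h₃ h₄

end Summit.Ventures.CertifiedManyBodySolver.Theses.M3ObsPd21UnitWindowViaRows
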